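import Summits.Langlands.Langlands.Theorems.PhantomRMYoshidaResiduallyYoshidaLiftingCrossRegularDefs
import Summits.Langlands.Langlands.Theorems.PhantomRMYoshidaResiduallyYoshidaLiftingReduction
import HarnessLib

/-!
# Route `PhantomRMYoshida`, crux `ResiduallyYoshidaLifting` (stmt-Langlands-13639), line
# `cross-regular-annihilator-primes`: stub S5 `stub_successiveApproximation` is implied by the route TARGET

S5 (`stub_successiveApproximation`: Mazur's principle mod `p^N` at the auxiliary cross-regular primes + the
limit `N → ∞` at the fixed level `𝔫₁`; Thorne 2016, Cor. 4.15 transplanted to `GSp₄`) concludes `Aut ρ` from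
the sector data of `ρ` together with a ×-type automorphic family at every depth `N`.  Dropping the family
hypothesis, its remaining hypotheses are exactly those of the route target
`Summit.Langlands.Langlands.Theses.PhantomRMYoshida.PhantomRMSector` except the two oddness hypotheses
`σ.IsOdd`, `σ'.IsOdd`, and these follow from the determinant clause `DetCond p σ σ'` (`det σ̄ = ε̄⁻¹ = det σ̄'`,
`ε̄(c) = −1`): the landed `YoshidaDivisorSelmerCount.isOdd_of_detC`, whose `DetC p k σ σ'` has the same
definiens as `DetCond p σ σ'` (the inline cyclotomic characters `εb p` and `epsBar p` are the identical term).
The target's inline shape / automorphy clauses are verbatim `Sh σ σ' red ρ` / `Aut hcpt ι ρ` (definitional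
unfolding, as in `stub_cruxUnfold`).

Hence S5 carries no risk beyond the route's own target: `PhantomRMSector → S5` (registered sub-goal
`stub_successiveApproximation_of_target` of stmt-Langlands-13639).  Nothing else is asserted.

References: J. Thorne, *Automorphy of some residually dihedral Galois representations*, Math. Ann. 364 (2016)
[Thorne2016, Thm. 4.14, Cor. 4.15].
-/

noncomputable section

set_option linter.dupNamespace false

open scoped Matrix Classical
open Filter

namespace Summit.Langlands.Langlands.Cruxes.ResiduallyYoshidaLifting.CrossRegularAnnihilatorPrimes

/-- The determinant clause `DetCond p σ σ'` of this line's currency IS the clause `DetC p k σ σ'` of line A's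
currency (`YoshidaDivisorSelmerCount`): both are the crux's inline determinant clause, verbatim. [folklore] -/
theorem detCond_iff_detC {p : ℕ} [Fact p.Prime] {k : Type} [Field k] [CharP k p] [TopologicalSpace k]
    [DiscreteTopology k] (σ σ' : Literature.NumberTheory.GaloisRepresentations.FramedGaloisRep ℚ k 2) :
    DetCond p σ σ' ↔
      Summit.Langlands.Langlands.Cruxes.ResiduallyYoshidaLifting.YoshidaDivisorSelmerCount.DetC p k σ σ' :=
  Iff.rfl

/-- `det σ̄ = ε̄⁻¹ = det σ̄' ⇒ σ̄, σ̄' odd` over this line's currency (`isOdd_of_detC` of line A, transported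
along `detCond_iff_detC`). [folklore] -/
theorem isOdd_of_detCond {p : ℕ} [Fact p.Prime] {k : Type} [Field k] [CharP k p] [TopologicalSpace k]
    [DiscreteTopology k] {σ σ' : Literature.NumberTheory.GaloisRepresentations.FramedGaloisRep ℚ k 2}
    (hdet : DetCond p σ σ') : σ.IsOdd ∧ σ'.IsOdd :=
  Summit.Langlands.Langlands.Cruxes.ResiduallyYoshidaLifting.YoshidaDivisorSelmerCount.isOdd_of_detC
    ((detCond_iff_detC σ σ').1 hdet)

/-- **S5 ≤ route target.** The registered stub `stub_successiveApproximation` (S5 of line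
`cross-regular-annihilator-primes`) follows from the route target `PhantomRMSector`: drop the ×-family
hypothesis and feed the target the two oddness facts obtained from `DetCond` (`isOdd_of_detCond`); the
target's inline `Sh` / `Aut` clauses are this line's `Sh` / `Aut` by definitional unfolding.  So S5 carries no
risk beyond the route's own. [cite: Thorne2016, Cor. 4.15 (the statement being compared)] -/
theorem stub_successiveApproximation_of_target :
    Summit.Langlands.Langlands.Theses.PhantomRMYoshida.PhantomRMSector → (∀ (p : ℕ) [Fact p.Prime], p ≠ 2 → ∀ (k : Type) [Field k] [CharP k p] [IsAlgClosed k] [TopologicalSpace k] [DiscreteTopology k] (red : Valued.integer (PadicAlgCl p) →+* k) (σ σ' : Literature.NumberTheory.GaloisRepresentations.FramedGaloisRep ℚ k 2) (hcpt : Literature.NumberTheory.Automorphic.isCompact_glFiniteIntegralLevel 4 ℚ) (ι : PadicAlgCl p ≃+* ℂ) (ρ : Literature.NumberTheory.GaloisRepresentations.FramedGaloisRep ℚ (PadicAlgCl p) 4), σ.toGaloisRep.IsIrreducible → σ'.toGaloisRep.IsIrreducible → Summit.Langlands.Langlands.Cruxes.ResiduallyYoshidaLifting.CrossRegularAnnihilatorPrimes.DetCond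 p σ σ' → (¬ ∃ g : GL (Fin 2) k, ∀ x, g * σ x * g⁻¹ = σ' x) → ρ.toGaloisRep.IsIrreducible → Summit.Langlands.Langlands.Cruxes.ResiduallyYoshidaLifting.CrossRegularAnnihilatorPrimes.Sh σ σ' red ρ → ∀ (𝔫₁ : Ideal (NumberField.RingOfIntegers ℚ)) (T₁ : Literature.NumberTheory.Automorphic.InfinityType ℚ 4), 𝔫₁ ≠ 0 → (∀ N : ℕ, ∃ Q : Finset (IsDedekindDomain.HeightOneSpectrum (NumberField.RingOfIntegers ℚ)), (∀ v ∈ Q, Summit.Langlands.Langlands.Cruxes.ResiduallyYoshidaLifting.CrossRegularAnnihilatorPrimes.QGood σ σ' red 𝔫₁ ρ N v) ∧ Summit.Langlands.Langlands.Cruxes.ResiduallyYoshidaLifting.CrossRegularAnnihilatorPrimes.CrossFamily σ σ' red hcpt ι 𝔫₁ T₁ Q N ρ) → Summit.Langlands.Langlands.Cruxes.ResiduallyYoshidaLifting.CrossRegularAnnihilatorPrimes.Aut hcpt ι ρ) := by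
  intro hT p _ hp k _ _ _ _ _ red σ σ' hcpt ι ρ hirr hirr' hdet hnc hirrρ hSh _𝔫₁ _T₁ _h𝔫₁ _hfam
  exact hT p hp k red σ σ' hcpt ι ρ (isOdd_of_detCond hdet).1 (isOdd_of_detCond hdet).2 hirr hirr' hdet hnc
    hirrρ hSh

end Summit.Langlands.Langlands.Cruxes.ResiduallyYoshidaLifting.CrossRegularAnnihilatorPrimes

end
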